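import Summits.KontsevichZagierPeriods.Zeta5Search.Certificates.RayH1KernelBigPrime
import Summits.KontsevichZagierPeriods.Zeta5Search.Certificates.RayH1KernelBrickTabC
import Summits.KontsevichZagierPeriods.Zeta5Search.Certificates.RayH1KernelAtlasWinB
import HarnessLib

/-!
# ζ(5) search — certificates: the BRICK ATLAS of the ray RayH1 in the kernel, exponent `0.7696` hypothesis-free (TYPER g16)

HONEST FRAMING: systematic search; no irrationality claim unless certified.  Valuation bookkeeping of explicit rationals; an
effective exponent `γ < 1` is a calibration, nothing about the arithmetic nature of `ζ(5)`.

OUR work (Summit side; typer seat, generation 16; generator `HOME/pub-zeta5-typer-g16/gen/gen_kernelbricks.py H1`).  Sequel of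
`RayH1KernelBigPrime` (`kM = kM0/Φ_K`, rate `141.7159`) and `RayH1KernelNuBrick` (`cell_brick_h1`).  TABLE-DRIVEN assembly:
the 768 certified `ν`-cells of the ray with `c ≥ 1`, read as `θ`-windows `(A_i, B_i]` with weights `2c_i` — for the shifts `m = 0, …, 3` of `x = n/p − m` (`m = 0`: `θ ∈ (1, 15]`;
`m ≥ 1`: `θ ∈ (1/(m+1), 1/m)`) —
(list table `brickTab` of `(A, B, 2c, cell)`, `RayKernelTables` format), pass ONE decidable checker `brickOK` (`brickOK_all`, `decide`) whose soundness
`brick_window_cert` gives `p^{2c_i} ∣ wedgeNumZ, qNumZ` for every prime of window `i` once `n ≥ 544`; the windows are sorted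
(`brick_chain`, linear check) hence disjoint, and disjoint from the big-prime atlas (`θ ≤ 15 < θ`).  `RayKernel.atlas_ints` over the index type
`Fin 4 ⊕ Fin brickTab.length` divides `Φ_K·Φ_B` out of `kM0`: `kMB n = kM0 n/(Φ_K Φ_B)`, integers for `n ≥ 544`, size
`kMB n ≤ e^{(57.3842+ε)n}` (`Σ 2c_i(B_i − A_i) = 84.3317`), hence
**`h1_exponent_bricks` — HYPOTHESIS-FREE: every `0 ≤ γ ≤ 0.7696` is an effective exponent of the ray** (ladder on this ray:
`h1_exponent_baseline` → `h1_exponent_bigPrime` → this; Brown–Zudilin tie `λ* = 42.929`, here `λ = 57.3842`).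
No irrationality content (`γ < 1`).  The Φ/(8.11) input is fam-denom 62 BY NAME (`RayKernel.brick_cert`); cells by fam-denom's checker.
-/

noncomputable section

open Finset Real Filter Topology

namespace Summit.KontsevichZagierPeriods.Zeta5Search.RayH1

open Summit.KontsevichZagierPeriods.Zeta5Search.DualSeries
open Summit.KontsevichZagierPeriods.Zeta5Search.DualSeriesDenominators
open Summit.KontsevichZagierPeriods.Zeta5Search.WedgeDictionary
open Summit.KontsevichZagierPeriods.Zeta5Search.RayKernel
open Summit.KontsevichZagierPeriods.Zeta5Search.Denom.DigitCert
open Literature.NumberTheory.Irrationality.Hata1992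
open Literature.NumberTheory.Transcendental (zetaValue)

/-! ### The brick atlas, indexed by `Fin brickTab.length` (768 windows) -/

/-- Left endpoint of brick window `i`. -/
def bA (i : Fin brickTab.length) : ℚ := (brickTab[(i : ℕ)]).1

/-- Right endpoint of brick window `i`. -/
def bB (i : Fin brickTab.length) : ℚ := (brickTab[(i : ℕ)]).2.1

/-- Weight of brick window `i`. -/
def bwt (i : Fin brickTab.length) : ℕ := (brickTab[(i : ℕ)]).2.2.1

/-- The brick windows are sorted and separated: `B_i ≤ A_j` for `i < j`. -/
theorem brick_sorted (i j : Fin brickTab.length) (hij : i < j) : bB i ≤ bA j :=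
  chainOK_sorted brick_chain i j hij j.isLt

/-- `Σ_i 2c_i·(B_i − A_i)` over the index type. -/
theorem brick_rate : ∑ i : Fin brickTab.length, (bwt i : ℚ) * (bB i - bA i) = 75168563718480656254882751420168481557136097 / 891344228678781777453918828695399851082400 := by
  rw [← brick_rate_list, ← sum_fin_getElem_eq_map_sum]
  rfl

/-! ### Soundness of the checker -/

/-- A BRICK entry of the table: unpack the checker's facts about its cell and shift. -/
theorem brickOK_sound (i : Fin brickTab.length) (h : brickCond (brickTab[(i : ℕ)]) = true) :
    ∃ C : Cell, ∃ m : ℕ, C ∈ h1Cells ∧ m ≤ 3 ∧ (C.b1 : ℚ) ≤ ((C.a1 : ℚ) + (m : ℚ) * C.b1) * bA i ∧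
      ((C.a0 : ℚ) + (m : ℚ) * C.b0) * bB i ≤ (C.b0 : ℚ) ∧ 0 < C.a1 ∧ 0 < C.a0 ∧ C.a0 < (C.b0 : ℤ) ∧ C.a1 ≤ (C.b1 : ℤ) ∧ 0 < C.b1 ∧
      ((bwt i : ℤ) ≤ 2 * C.c) ∧ 1 ≤ ((m : ℚ) + 1) * bA i ∧ bA i ≤ bB i ∧ bB i ≤ 15 ∧ C.b0 ≤ 34 ∧ C.b1 ≤ 34 := by
  simp only [brickCond, Bool.and_eq_true, decide_eq_true_eq, and_assoc] at h
  obtain ⟨hlen, hm, h1, h2, h3, h4, h5, h6, h7, h8, h9, h10, h11, h12, h13⟩ := h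
  refine ⟨h1Cells.getD ((brickTab[(i : ℕ)]).2.2.2 / 8) ⟨0, 1, 0, 1, 0, []⟩, (brickTab[(i : ℕ)]).2.2.2 % 8, ?_, hm, h1, h2, h3, h4,
    h5, h6, h7, h8, h9, h10, h11, h12, h13⟩
  rw [List.getD_eq_getElem _ _ hlen]
  exact List.getElem_mem hlen

/-- The atlas-window index of entry `i` (meaningful on atlas entries). -/
def bIdx (i : Fin brickTab.length) : ℕ := (brickTab[(i : ℕ)]).2.2.2 / 8

/-- An ATLAS entry of the table: unpack the checker's facts (in terms of `bA`, `bB`, `bwt`, `bIdx`). -/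
theorem atlasOK_sound (i : Fin brickTab.length) (h : atlasCond (brickTab[(i : ℕ)]) = true) :
    bIdx i < 9 ∧ aLo (bIdx i) ≤ bA i ∧ bB i ≤ aHi (bIdx i) ∧ bwt i ≤ aK (bIdx i) ∧ 1 ≤ bA i ∧ bA i ≤ bB i ∧ bB i ≤ 15 := by
  simp only [atlasCond, Bool.and_eq_true, decide_eq_true_eq, and_assoc] at h
  obtain ⟨-, h1, h2, h3, h4, h5, h6, h7⟩ := h
  exact ⟨h1, h2, h3, h4, h5, h6, h7⟩

/-- Every entry: `0 < A_i ≤ B_i ≤ 15` (either branch of the checker). -/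
theorem entry_basic (i : Fin brickTab.length) : 0 < bA i ∧ bA i ≤ bB i ∧ bB i ≤ 15 := by
  have h := getElem_all brickOK_all i i.isLt
  rw [brickOK, Bool.or_eq_true] at h
  rcases h with h | h
  · obtain ⟨-, -, -, -, hA1, hAB, hBlo⟩ := atlasOK_sound i h
    clear h
    exact ⟨by linarith, hAB, hBlo⟩
  · obtain ⟨-, m, -, -, -, -, -, -, -, -, -, -, hA1, hAB, hBlo, -⟩ := brickOK_sound i h
    clear h
    have hm0 : (0 : ℚ) < (m : ℚ) + 1 := by positivity
    exact ⟨by nlinarith, hAB, hBlo⟩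

/-- `0 < A_i` for every window. -/
theorem bA_pos (i : Fin brickTab.length) : 0 < bA i := (entry_basic i).1

/-- **Dispatch to the atlas certificates**: a prime of atlas window `j` (`aLo j·n < p ≤ aHi j·n`) carries `p^(aK j) ∣ wedgeNumZ, qNumZ`
(`RayH1KernelAtlasWin*.atlasCert_*`, `n ≥ 544`). -/
theorem atlas_dispatch {n p : ℕ} (hn : 544 ≤ n) (hp : p.Prime) {j : ℕ} (hj : j < 9) (hlo : aLo j * n < p)
    (hhi : (p : ℚ) ≤ aHi j * n) :
    (p : ℤ) ^ aK j ∣ wedgeNumZ (bH1 n) (bH1' n) ∧ (p : ℤ) ^ aK j ∣ qNumZ (bH1 n) (bH1' n) := by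
  have hn' : 35 ≤ n := by omega
  interval_cases j
  · simp only [aLo, aHi, aK] at hlo hhi ⊢
    exact atlasCert_Ray4WindowA4M52 hn' hp (by exact_mod_cast (show (n : ℚ) < (p : ℚ) by linarith)) (by exact_mod_cast (show (17 : ℚ) * p ≤ (18 : ℚ) * n by linarith))
  · simp only [aLo, aHi, aK] at hlo hhi ⊢
    exact atlasCert_Ray4WindowO8 hn' hp (by exact_mod_cast (show (15 : ℚ) * n < (2 : ℚ) * p by linarith)) (by exact_mod_cast (show (p : ℚ) ≤ (8 : ℚ) * n by linarith))
  · simp only [aLo, aHi, aK] at hlo hhi ⊢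
    exact atlasCert_Ray4WindowO26 hn' hp (by exact_mod_cast (show (2 : ℚ) * n < (p : ℚ) by linarith)) (by exact_mod_cast (show (12 : ℚ) * p ≤ (25 : ℚ) * n by linarith))
  · simp only [aLo, aHi, aK] at hlo hhi ⊢
    exact atlasCert_Ray4WindowL5M52 hn' hp (by exact_mod_cast (show (n : ℚ) < (p : ℚ) by linarith)) (by exact_mod_cast (show (24 : ℚ) * p ≤ (25 : ℚ) * n by linarith))
  · simp only [aLo, aHi, aK] at hlo hhi ⊢
    exact atlasCert_Ray4WindowZ17o9 hn' hp (by exact_mod_cast (show (17 : ℚ) * n < (9 : ℚ) * p by linarith)) (by exact_mod_cast (show (13 : ℚ) * p ≤ (25 : ℚ) * n by linarith))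
  · simp only [aLo, aHi, aK] at hlo hhi ⊢
    exact atlasCert_Ray4WindowZ15o8 hn' hp (by exact_mod_cast (show (15 : ℚ) * n < (8 : ℚ) * p by linarith)) (by exact_mod_cast (show (9 : ℚ) * p ≤ (17 : ℚ) * n by linarith))
  · simp only [aLo, aHi, aK] at hlo hhi ⊢
    exact atlasCert_Ray4WindowZ16o11 hn' hp (by exact_mod_cast (show (16 : ℚ) * n < (11 : ℚ) * p by linarith)) (by exact_mod_cast (show (17 : ℚ) * p ≤ (25 : ℚ) * n by linarith))
  · simp only [aLo, aHi, aK] at hlo hhi ⊢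
    exact atlasCert_Ray4WindowZ11o8 hn' hp (by exact_mod_cast (show (11 : ℚ) * n < (8 : ℚ) * p by linarith)) (by exact_mod_cast (show (13 : ℚ) * p ≤ (18 : ℚ) * n by linarith))
  · simp only [aLo, aHi, aK] at hlo hhi ⊢
    exact atlasCert_Ray4WindowZ34o11 hn' hp (by exact_mod_cast (show (34 : ℚ) * n < (11 : ℚ) * p by linarith)) (by exact_mod_cast (show (8 : ℚ) * p ≤ (25 : ℚ) * n by linarith))

/-- **Soundness: a prime of brick window `i` carries the certificate `p^{2c_i} ∣ wedgeNumZ, qNumZ`** (`n ≥ 544`). -/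
theorem brick_window_cert {n : ℕ} (hn : 544 ≤ n) (i : Fin brickTab.length) {p : ℕ}
    (hp : p ∈ windowPrimes ((bA i : ℚ) : ℝ) ((bB i : ℚ) : ℝ) n) :
    (p : ℤ) ^ bwt i ∣ wedgeNumZ (bH1 n) (bH1' n) ∧ (p : ℤ) ^ bwt i ∣ qNumZ (bH1 n) (bH1' n) := by
  have hA0 : (0 : ℝ) ≤ ((bA i : ℚ) : ℝ) := by exact_mod_cast (bA_pos i).le
  obtain ⟨hpr, hlow, hhigh⟩ := (mem_windowPrimes_iff hA0).1 hp
  have hall := getElem_all brickOK_all i i.isLt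
  rw [brickOK, Bool.or_eq_true] at hall
  rcases hall with hatl | hbrk
  · -- atlas branch
    obtain ⟨hw, hlo', hhi', hk', -, -, -⟩ := atlasOK_sound i hatl
    clear hatl
    have hlow' : (bA i : ℚ) * n < p := by exact_mod_cast hlow
    have hhigh' : (p : ℚ) ≤ (bB i : ℚ) * n := by exact_mod_cast hhigh
    have hn0 : (0 : ℚ) ≤ n := by positivity
    have h1 : aLo (bIdx i) * n < p := by
      have := mul_le_mul_of_nonneg_right hlo' hn0
      exact lt_of_le_of_lt this hlow'
    have h2 : (p : ℚ) ≤ aHi (bIdx i) * n := hhigh'.trans (mul_le_mul_of_nonneg_right hhi' hn0)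
    have hd := atlas_dispatch hn hpr hw h1 h2
    exact ⟨(pow_dvd_pow (p : ℤ) hk').trans hd.1, (pow_dvd_pow (p : ℤ) hk').trans hd.2⟩
  obtain ⟨C, m, hC, hm, h1, h2, ha1, ha0, ha0b0, ha1b1, hb1pos, hk, hA1, hAB, hBlo, hb0, hb1⟩ := brickOK_sound i hbrk
  clear hbrk
  have hlow' : (bA i : ℚ) * n < p := by exact_mod_cast hlow
  have hhigh' : (p : ℚ) ≤ (bB i : ℚ) * n := by exact_mod_cast hhigh
  have hn1 : 1 ≤ n := by omega
  have hnq : (544 : ℚ) ≤ n := by exact_mod_cast hn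
  have hn0 : (0 : ℚ) ≤ n := by positivity
  have hm1 : (0 : ℚ) < (m : ℚ) + 1 := by positivity
  have hmq : (m : ℚ) ≤ 3 := by exact_mod_cast hm
  -- p > n/(m+1)
  have hpgt : (n : ℚ) < ((m : ℚ) + 1) * p := by nlinarith
  -- p > cmax
  have hpc : (34 : ℚ) + 1 < p := by nlinarith
  have hpcN : 34 < p := by exact_mod_cast (show (34 : ℚ) < p by linarith)
  have hpb0 : (C.b0 : ℕ) < p := by omega
  -- p ≤ B0 n and B0 n < p²
  have hpB : p ≤ 15 * n := by
    have : (p : ℚ) ≤ 15 * n := by nlinarith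
    exact_mod_cast this
  have hsq : 34 * n < p ^ 2 := by
    have h3 : (34 : ℚ) * n * 16 ≤ (n : ℚ) * n := by nlinarith
    have h4 : (n : ℚ) * n < (((m : ℚ) + 1) * p) * (((m : ℚ) + 1) * p) := mul_self_lt_mul_self hn0 hpgt
    have hm4 : (m : ℚ) + 1 ≤ 4 := by linarith
    have hp0' : (0 : ℚ) ≤ p := by positivity
    have h5a : ((m : ℚ) + 1) * p ≤ 4 * p := mul_le_mul_of_nonneg_right hm4 hp0'
    have h5 : (((m : ℚ) + 1) * p) * (((m : ℚ) + 1) * p) ≤ (4 * p) * (4 * (p : ℚ)) :=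
      mul_le_mul h5a h5a (by positivity) (by positivity)
    have : (34 : ℚ) * n < (p : ℚ) ^ 2 := by nlinarith [h3, h4, h5]
    exact_mod_cast this
  -- the cell inequalities in the `(a + m b)` form
  have hx1q : (C.b1 : ℚ) * n < ((C.a1 : ℚ) + (m : ℚ) * C.b1) * p := by
    have hpos : (0 : ℚ) < (C.a1 : ℚ) + (m : ℚ) * C.b1 := by
      have : (0 : ℚ) < C.a1 := by exact_mod_cast ha1
      have : (0 : ℚ) ≤ (m : ℚ) * C.b1 := by positivity
      linarith
    nlinarith
  have hx0le : ((C.a0 : ℚ) + (m : ℚ) * C.b0) * p ≤ (C.b0 : ℚ) * n := by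
    have hpos : (0 : ℚ) < (C.a0 : ℚ) + (m : ℚ) * C.b0 := by
      have : (0 : ℚ) < C.a0 := by exact_mod_cast ha0
      have : (0 : ℚ) ≤ (m : ℚ) * C.b0 := by positivity
      linarith
    nlinarith
  have hx1z : (C.b1 : ℤ) * n < (C.a1 + (m : ℤ) * C.b1) * p := by exact_mod_cast hx1q
  have hx0z' : (C.a0 + (m : ℤ) * C.b0) * p ≤ (C.b0 : ℤ) * n := by exact_mod_cast hx0le
  have hb0z : (0 : ℤ) < C.b0 := by have := ha0b0; linarith
  have hb1z : (0 : ℤ) < C.b1 := by exact_mod_cast hb1pos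
  -- strictness of the upper inequality
  have hx0z : (C.a0 + (m : ℤ) * C.b0) * p < (C.b0 : ℤ) * n := by
    rcases hx0z'.lt_or_eq with hlt | heq
    · exact hlt
    · exfalso
      have hdvd : (p : ℤ) ∣ (C.b0 : ℤ) * n := ⟨C.a0 + (m : ℤ) * C.b0, by linarith⟩
      have hdvd' : p ∣ C.b0 * n := by exact_mod_cast hdvd
      rcases (Nat.Prime.dvd_mul hpr).1 hdvd' with h | h
      · exact absurd (Nat.le_of_dvd (by exact_mod_cast hb0z) h) (by omega)
      · obtain ⟨q, hq⟩ := h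
        have hq' : (n : ℤ) = p * q := by exact_mod_cast hq
        rw [hq'] at heq
        have hp0 : (0 : ℤ) < p := by exact_mod_cast hpr.pos
        have e1 : C.a0 = C.b0 * ((q : ℤ) - m) := by
          have : (p : ℤ) * (C.a0 + (m : ℤ) * C.b0 - C.b0 * q) = 0 := by linarith
          rcases mul_eq_zero.1 this with h0 | h0
          · linarith
          · linarith
        have t1 : 0 < (q : ℤ) - m := by
          by_contra hcon
          have : C.b0 * ((q : ℤ) - m) ≤ 0 := mul_nonpos_of_nonneg_of_nonpos hb0z.le (not_lt.1 hcon)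
          linarith
        have t2 : (q : ℤ) - m < 1 := by
          by_contra hcon
          have : C.b0 * 1 ≤ C.b0 * ((q : ℤ) - m) := mul_le_mul_of_nonneg_left (not_lt.1 hcon) hb0z.le
          linarith
        omega
  -- p ∤ n
  have hnd : ¬ p ∣ n := by
    rintro ⟨q, hq⟩
    have hq' : (n : ℤ) = p * q := by exact_mod_cast hq
    rw [hq'] at hx0z hx1z
    have hp0 : (0 : ℤ) < p := by exact_mod_cast hpr.pos
    have k0 : C.a0 + (m : ℤ) * C.b0 < C.b0 * q := lt_of_mul_lt_mul_right (by linarith [hx0z]) hp0.le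
    have k1 : C.b1 * (q : ℤ) < C.a1 + (m : ℤ) * C.b1 := lt_of_mul_lt_mul_right (by linarith [hx1z]) hp0.le
    have t2 : (q : ℤ) - m < 1 := by
      by_contra hcon
      have : C.b1 * 1 ≤ C.b1 * ((q : ℤ) - m) := mul_le_mul_of_nonneg_left (not_lt.1 hcon) hb1z.le
      linarith
    have t1 : 0 < (q : ℤ) - m := by
      by_contra hcon
      have : C.b0 * ((q : ℤ) - m) ≤ 0 := mul_nonpos_of_nonneg_of_nonpos hb0z.le (not_lt.1 hcon)
      linarith
    omega
  have hx0 : C.a0 * (p : ℤ) < (C.b0 : ℤ) * ((n : ℤ) - m * p) := by linarith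
  have hx1 : (C.b1 : ℤ) * ((n : ℤ) - m * p) < C.a1 * (p : ℤ) := by linarith
  exact cell_brick_shift_h1 hC hn1 hpr hnd (by omega) hsq (by omega) m hx0 hx1 hk

/-! ### The combined atlas `Φ_K · Φ_B` over `Fin 4 ⊕ Fin brickTab.length` -/

/-- Left endpoints of the combined atlas (big-prime windows, then brick windows), real. -/
def cA : Fin 4 ⊕ Fin brickTab.length → ℝ := Sum.elim AwK (fun i => ((bA i : ℚ) : ℝ))

/-- Right endpoints of the combined atlas. -/
def cB : Fin 4 ⊕ Fin brickTab.length → ℝ := Sum.elim BwK (fun i => ((bB i : ℚ) : ℝ))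

/-- Weights of the combined atlas. -/
def cw : Fin 4 ⊕ Fin brickTab.length → ℕ := Sum.elim wwK bwt

/-- The combined window factor `Φ_n = Φ_K · Φ_B`. -/
def corrB (n : ℕ) : ℕ := multiWindowProd Finset.univ cA cB cw n

/-- **The multiplier** `kMB n = kM0 n / (Φ_K Φ_B)`. -/
def kMB (n : ℕ) : ℚ := kM0 n / (corrB n : ℚ)

/-- The windows are genuine intervals: `0 ≤ A ≤ B`. -/
theorem cA_le_cB : ∀ i ∈ (Finset.univ : Finset (Fin 4 ⊕ Fin brickTab.length)), 0 ≤ cA i ∧ cA i ≤ cB i := by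
  rintro (i | i) -
  · exact AwK_le_BwK i (Finset.mem_univ _)
  · obtain ⟨hA0, hAB, -⟩ := entry_basic i
    simp only [cA, cB, Sum.elim_inr]
    exact ⟨by exact_mod_cast hA0.le, by exact_mod_cast hAB⟩

/-- The rate of the combined atlas: `178 + Σ 2c_i(B_i − A_i)`. -/
theorem combined_rate : ∑ i ∈ (Finset.univ : Finset (Fin 4 ⊕ Fin brickTab.length)), (cw i : ℝ) * (cB i - cA i) =
    178 + ((75168563718480656254882751420168481557136097 / 891344228678781777453918828695399851082400 : ℚ) : ℝ) := by
  rw [Fintype.sum_sum_type]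
  simp only [cw, cA, cB, Sum.elim_inl, Sum.elim_inr]
  rw [window_rateK, ← brick_rate]
  push_cast
  rfl

/-- Two windows with `B₁ ≤ A₂` carry disjoint prime sets. -/
theorem windowPrimes_disjoint_of_le {A₁ B₁ A₂ B₂ : ℝ} (hA₁ : 0 ≤ A₁) (hA₂ : 0 ≤ A₂) (h : B₁ ≤ A₂) (n : ℕ) :
    Disjoint (windowPrimes A₁ B₁ n) (windowPrimes A₂ B₂ n) := by
  rw [Finset.disjoint_left]
  intro p h1 h2
  obtain ⟨-, -, b1⟩ := (mem_windowPrimes_iff hA₁).1 h1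
  obtain ⟨-, a2, -⟩ := (mem_windowPrimes_iff hA₂).1 h2
  have hn : (0 : ℝ) ≤ n := Nat.cast_nonneg n
  nlinarith

/-- The combined windows are pairwise disjoint (big-prime windows lie above `θ = 15`, brick windows below, both families sorted). -/
theorem combined_disjoint (n : ℕ) : ∀ i ∈ (Finset.univ : Finset (Fin 4 ⊕ Fin brickTab.length)), ∀ j ∈ (Finset.univ : Finset (Fin 4 ⊕ Fin brickTab.length)),
    i ≠ j → Disjoint (windowPrimes (cA i) (cB i) n) (windowPrimes (cA j) (cB j) n) := by
  rintro (i | i) - (j | j) - hij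
  · exact windowsK_disjoint n i (Finset.mem_univ _) j (Finset.mem_univ _) (fun h => hij (by rw [h]))
  · obtain ⟨-, -, hBlo⟩ := entry_basic j
    have hAi : (15 : ℝ) ≤ AwK i := by fin_cases i <;> simp [AwK] <;> norm_num
    have hBj : ((bB j : ℚ) : ℝ) ≤ 15 := by exact_mod_cast hBlo
    have h0j : (0 : ℝ) ≤ ((bA j : ℚ) : ℝ) := by exact_mod_cast (bA_pos j).le
    show Disjoint (windowPrimes (AwK i) (BwK i) n) (windowPrimes ((bA j : ℚ) : ℝ) ((bB j : ℚ) : ℝ) n)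
    exact (windowPrimes_disjoint_of_le h0j (AwK_le_BwK i (Finset.mem_univ _)).1 (by linarith) n).symm
  · obtain ⟨-, -, hBlo⟩ := entry_basic i
    have hAj : (15 : ℝ) ≤ AwK j := by fin_cases j <;> simp [AwK] <;> norm_num
    have hBi : ((bB i : ℚ) : ℝ) ≤ 15 := by exact_mod_cast hBlo
    have h0i : (0 : ℝ) ≤ ((bA i : ℚ) : ℝ) := by exact_mod_cast (bA_pos i).le
    show Disjoint (windowPrimes ((bA i : ℚ) : ℝ) ((bB i : ℚ) : ℝ) n) (windowPrimes (AwK j) (BwK j) n)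
    exact windowPrimes_disjoint_of_le h0i (AwK_le_BwK j (Finset.mem_univ _)).1 (by linarith) n
  · have hij' : i ≠ j := fun h => hij (by rw [h])
    have h0i : (0 : ℝ) ≤ ((bA i : ℚ) : ℝ) := by exact_mod_cast (bA_pos i).le
    have h0j : (0 : ℝ) ≤ ((bA j : ℚ) : ℝ) := by exact_mod_cast (bA_pos j).le
    show Disjoint (windowPrimes ((bA i : ℚ) : ℝ) ((bB i : ℚ) : ℝ) n) (windowPrimes ((bA j : ℚ) : ℝ) ((bB j : ℚ) : ℝ) n)
    rcases lt_or_gt_of_ne hij' with hlt | hlt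
    · have hs : ((bB i : ℚ) : ℝ) ≤ ((bA j : ℚ) : ℝ) := by exact_mod_cast brick_sorted i j hlt
      exact windowPrimes_disjoint_of_le h0i h0j hs n
    · have hs : ((bB j : ℚ) : ℝ) ≤ ((bA i : ℚ) : ℝ) := by exact_mod_cast brick_sorted j i hlt
      exact (windowPrimes_disjoint_of_le h0j h0i hs n).symm

/-- **`0 < kMB n`, `kMB n · P_n ∈ ℤ`, `kMB n · Q(a·n) ∈ ℤ`** for `n ≥ 544` (`RayKernel.atlas_ints`, certificates dispatched by window kind). -/
theorem kMB_ints {n : ℕ} (hn : 544 ≤ n) :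
    0 < kMB n ∧ (∃ z : ℤ, kMB n * h1P n = z) ∧ (∃ z : ℤ, kMB n * (h1Q n : ℚ) = z) := by
  classical
  have hn1 : 1 ≤ n := by omega
  have h := atlas_ints (Finset.univ : Finset (Fin 4 ⊕ Fin brickTab.length)) cA cB cw n (sharpAdmissible_bH1 hn1)
    (sharpAdmissible_bH1' hn1) (bn0_bH1' n) (rhoOf_aH1_ne_zero n) (fun i _ p hp => ?_) (combined_disjoint n)
  · obtain ⟨h0, hP, hQ⟩ := h
    refine ⟨h0, ?_, ?_⟩
    · unfold kMB kM0 corrB h1P; exact hP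
    · unfold kMB kM0 corrB; rw [h1Q_eq_wedge hn1]; exact hQ
  · rcases i with i | i
    · simp only [cA, cB, cw, Sum.elim_inl] at hp ⊢
      obtain ⟨hpr, hlo, hhi, hk⟩ := windowK_prime hp
      exact cert_bH1 hn1 hpr hlo hhi hk
    · simp only [cA, cB, cw, Sum.elim_inr] at hp ⊢
      exact brick_window_cert hn i hp

/-- **Size of the multiplier**: for every `ε > 0`, eventually `kMB n ≤ e^{(57.3842… + ε)·n}` (exact rate `3197159/10000 − 178 − Σ2c_iΔθ_i`). -/
theorem eventually_kMB_le_exp {ε : ℝ} (hε : 0 < ε) :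
    ∀ᶠ n : ℕ in atTop, ((kMB n : ℚ) : ℝ) ≤ Real.exp ((((1278727146463467856014976597883648354971804829 / 22283605716969544436347970717384996277060000 : ℚ) : ℝ) + ε) * n) := by
  have hε2 : 0 < ε / 2 := by positivity
  have hΦ := eventually_exp_le_multiWindowProd (s := (Finset.univ : Finset (Fin 4 ⊕ Fin brickTab.length))) (w := cw) cA_le_cB hε2
  filter_upwards [eventually_kM0_le_exp hε2, hΦ] with n hM0 hcorr
  rw [combined_rate] at hcorr
  have hcorr' : Real.exp ((178 + ((75168563718480656254882751420168481557136097 / 891344228678781777453918828695399851082400 : ℚ) : ℝ) - ε / 2) * n) ≤ ((corrB n : ℕ) : ℝ) := hcorr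
  have hcpos : (0 : ℝ) < ((corrB n : ℕ) : ℝ) := by exact_mod_cast multiWindowProd_pos _ _ _ _ _
  have hcast : ((kMB n : ℚ) : ℝ) = ((kM0 n : ℚ) : ℝ) / ((corrB n : ℕ) : ℝ) := by
    unfold kMB; push_cast; rfl
  rw [hcast]
  have hq : (((1278727146463467856014976597883648354971804829 / 22283605716969544436347970717384996277060000 : ℚ) : ℝ)) = 3197159 / 10000 - 178 - ((75168563718480656254882751420168481557136097 / 891344228678781777453918828695399851082400 : ℚ) : ℝ) := by push_cast; ring
  calc ((kM0 n : ℚ) : ℝ) / ((corrB n : ℕ) : ℝ) ≤ Real.exp ((3197159 / 10000 + ε / 2) * n) / ((corrB n : ℕ) : ℝ) :=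
        div_le_div_of_nonneg_right hM0 hcpos.le
    _ ≤ Real.exp ((3197159 / 10000 + ε / 2) * n) / Real.exp ((178 + ((75168563718480656254882751420168481557136097 / 891344228678781777453918828695399851082400 : ℚ) : ℝ) - ε / 2) * n) :=
        div_le_div_of_nonneg_left (Real.exp_pos _).le (Real.exp_pos _) hcorr'
    _ = Real.exp ((((1278727146463467856014976597883648354971804829 / 22283605716969544436347970717384996277060000 : ℚ) : ℝ) + ε) * n) := by rw [← Real.exp_sub, hq]; ring_nf

/-- **THE EXPONENT `0.7696` OF THE RAY RayH1, HYPOTHESIS-FREE** (baseline `d⁹N♯N♯′/|ρ|` ÷ big-prime atlas ÷ brick atlas).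
For every `0 ≤ γ ≤ 0.7696`, eventually `|ζ(5) − P_n/Q(a·n)| < 1/q_n^γ` with the integers `p_n = kMB n·P_n`, `q_n = kMB n·|Q(a·n)| ≥ 1`.
Arithmetic: `0.7696·(57.4042 + 72.9346) < 72.9343 + 27.3999`; (HD) of `h1_exponent` discharged at `λ = 57.3842`
(Brown–Zudilin tie `λ* = 42.929`).  No irrationality content (`γ < 1`). -/
theorem h1_exponent_bricks {γ : ℝ} (hγ0 : 0 ≤ γ) (hγ : γ ≤ 481 / 625) :
    ∀ᶠ n : ℕ in atTop, ∃ p : ℤ, ∃ q : ℕ, 1 ≤ q ∧ (q : ℚ) = kMB n * |(h1Q n : ℚ)| ∧ (p : ℚ) = kMB n * h1P n ∧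
      |zetaValue 5 - (h1P n : ℝ) / (h1Q n : ℝ)| < 1 / (q : ℝ) ^ γ := by
  have hq : (((1278727146463467856014976597883648354971804829 / 22283605716969544436347970717384996277060000 : ℚ) : ℝ)) = 1278727146463467856014976597883648354971804829 / 22283605716969544436347970717384996277060000 := by push_cast; ring
  refine h1_exponent_rat (lam := 1278727146463467856014976597883648354971804829 / 22283605716969544436347970717384996277060000 + 1 / 100) kMB (fun ε hε => ?_) hγ0 (by nlinarith)
  filter_upwards [eventually_kMB_le_exp hε, eventually_ge_atTop 544] with n hn hnN
  obtain ⟨h0, hP, hQ⟩ := kMB_ints hnN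
  refine ⟨h0, hP, hQ, hn.trans ?_⟩
  rw [hq]
  apply Real.exp_le_exp.2; nlinarith [hε, (Nat.cast_nonneg n : (0:ℝ) ≤ n)]

end Summit.KontsevichZagierPeriods.Zeta5Search.RayH1
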